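import Mathlib.Analysis.SpecialFunctions.SmoothTransition
import Mathlib.Analysis.SpecialFunctions.Pow.Deriv
import Mathlib.Analysis.InnerProductSpace.Calculus
import Mathlib.Analysis.Calculus.FDeriv.Measurable
import Literature.Analysis.FluidPDE.VorticityCalculus
import Literature.Analysis.FunctionSpaces.TorusPeriodizationCube
import HarnessLib

/-!
# Point-collapse debris: the truncated homogeneous field `D_{α,W} = curl (χ(|z|) |z|^{1-α} W(z/|z|))`

Analysis/FluidPDE definition file (notion `collapseDebris`), naming the object abbreviated by the
`let D := …` / `let Adm := …` prefixes of the items `RecurrentDebris`, `RobustDecayQuantum`,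
`DecayQuantumWeak`, `DebrisDatumRegular` of route
`Summit.AnomalousDissipation.AnomalousDissipation.Theses.DebrisQuanta` (card
`onsager-quanta-collapse-exponent-map`): the degree-`(-α)` homogeneous divergence-free field
`U_{α,W} = curl (|z|^{1-α} W(z/|z|))` (the homogeneous ansatz `V = (v + f n)/|x|^α` of
Shvydkoy, §1 eq. (2); energy in `B_ρ` of order `ρ^{3-2α}`, the energy-measure dimension `N - 2α`
of Bronzi–Shvydkoy, Thm. 1.1 / Rem. 1.2), smoothly truncated to the ball of radius `1/4` about the
centre of the fundamental cube and read on the flat torus `T³`. All objects live on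
`ℝ³ = EuclideanSpace ℝ (Fin 3)` and are moved to `T³` by `Torus.repr`:

* `CollapseDebris.cutoff r = smoothTransition (2 - 8 r)` (`= 1` for `r ≤ 1/8`, `= 0` for
  `r ≥ 1/4`, smooth, values in `[0, 1]`);
* `CollapseDebris.homogeneousPotential α W z = |z|^{1-α} • W (|z|⁻¹ z)`,
  `CollapseDebris.homogeneousField α W = curl (homogeneousPotential α W)` (`= U_{α,W}`);
* `CollapseDebris.potential α W z = (χ(|z|) |z|^{1-α}) • W (|z|⁻¹ z)`,
  `CollapseDebris.field α W = curl (potential α W)`: supported in the closed ball of radius `1/4`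
  (`field_eq_zero`, `hasCompactSupport_field`), equal to `U_{α,W}` on the open ball of radius
  `1/8` (`field_eq_homogeneousField`), smooth off the origin for smooth `W` (`contDiffAt_field`),
  Borel measurable for every `W` (`measurable_field`);
* `CollapseDebris.centre = (½, ½, ½)` and `collapseDebris α W x = field α W (repr x - centre)`:
  **the debris field on `T³`**, by `rfl` the route's `D α W x` (`collapseDebris_eq`); it vanishes
  where `|repr x - centre| > 1/4`, is measurable, and is the torus periodisation of
  `y ↦ field α W (y - centre)` (`collapseDebris_eq_periodize`: the bridge to the
  `Torus.periodize` dictionary of `TorusPeriodization(Cube)` — lifts, integrals, smoothness);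
* `CollapseDebris.IsAdmissibleProfile α W` (`W ∈ C^∞` and `U_{α,W} ≢ 0` off the origin), by
  `Iff.rfl` the route's `Adm α W` (`isAdmissibleProfile_iff`); the swirl profile
  `W₀ y = (0, y₀, 1)` of item `DecayQuantumWeak` is admissible for every `α`
  (`isAdmissibleProfile_swirl`: `U_{α,W₀}(e₂)` has third component `1`).

Deliberately NOT here (left to the route's provers, item `DebrisDatumRegular`):
`collapseDebris α W ∈ L²(T³)` for `α < 3/2`, its weak divergence-freeness on `T³` (the potential
is only `W^{1,p}` at the origin), the shell-energy asymptotics `∫_{B_ρ} |D|² ≍ ρ^{3-2α}`; nothing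
about Euler / Navier–Stokes dynamics is asserted. Tree search (2026-08-15): Mathlib has
`Real.smoothTransition`, `contDiffAt_norm`, `ContDiffAt.rpow_const_of_ne`, `measurable_fderiv`, no
curl; the tree has `curl` (`VectorCalculus`), `curlCLM`/`curl_eq_curlCLM`
(`TaoEnstrophyLocalisation`), `contDiff_curl` (`VorticityCalculus`), `Torus.repr`/`Torus.periodize`/
`Torus.periodize_eq_apply_repr` (`FlatTorus`, `TorusPeriodization(Cube)`); no `collapseDebris`,
`homogeneousField`, or `IsAdmissibleProfile` outside `DeRosa.`.

## References

* R. Shvydkoy, *Homogeneous solutions to the 3D Euler system*, Trans. Amer. Math. Soc. 370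
  (2018) 2517–2535, arXiv:1510.03378, §1 eq. (2) (key `Shvydkoy2017`).
* A. Bronzi, R. Shvydkoy, *On the energy behavior of locally self-similar blowup for the Euler
  equation*, Indiana Univ. Math. J. 64 (2015), arXiv:1310.8611, Thm. 1.1, Rem. 1.2.
* A. J. Majda, A. L. Bertozzi, *Vorticity and Incompressible Flow* (CUP 2002), §1.1–1.2.
-/

noncomputable section

open MeasureTheory Set Function Filter Topology Metric WithLp
open scoped ContDiff

namespace Literature.Analysis.FluidPDE

/-- Local notation for physical space `ℝ³ = EuclideanSpace ℝ (Fin 3)`. -/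
local notation "ℝ³" => EuclideanSpace ℝ (Fin 3)

/-! ## Two general facts about the tree's `curl` -/

/-- The curl of any field `v : ℝ³ → ℝ³` is Borel measurable: `curl v = curlCLM ∘ Dv`
(`curl_eq_curlCLM_comp`) and `x ↦ Dv(x)` is measurable for every `v` (Mathlib's
`measurable_fderiv`, junk value `0` off the differentiability set included). [folklore] -/
theorem measurable_curl (v : ℝ³ → ℝ³) : Measurable (curl v) := by
  rw [curl_eq_curlCLM_comp]
  exact curlCLM.continuous.measurable.comp (measurable_fderiv ℝ v)

/-- The curl of a field that is `C^{n+1}` *near a point* is `Cⁿ` near that point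
(local form of `contDiff_curl`; `curl = curlCLM ∘ D`). [folklore] -/
theorem contDiffAt_curl {v : ℝ³ → ℝ³} {x : ℝ³} {m n : WithTop ℕ∞} (hv : ContDiffAt ℝ n v x)
    (hmn : m + 1 ≤ n) : ContDiffAt ℝ m (curl v) x := by
  rw [curl_eq_curlCLM_comp]
  exact curlCLM.contDiff.contDiffAt.comp x (hv.fderiv_right hmn)

namespace CollapseDebris

/-! ## The radial cutoff -/

/-- The radial cutoff `χ(r) = smoothTransition (2 - 8 r)` of the debris construction: smooth,
`χ = 1` on `r ≤ 1/8`, `χ = 0` on `r ≥ 1/4`, `0 ≤ χ ≤ 1` (route DebrisQuanta, docstring of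
`DebrisDatumRegular`: "chi(r) = smoothTransition(2−8r) (=1 for r≤1/8, =0 for r≥1/4)"). [folklore] -/
def cutoff (r : ℝ) : ℝ :=
  Real.smoothTransition (2 - 8 * r)

/-- `χ(r) = 1` for `r ≤ 1/8`. [folklore] -/
theorem cutoff_eq_one {r : ℝ} (hr : r ≤ 1 / 8) : cutoff r = 1 :=
  Real.smoothTransition.one_of_one_le (by linarith)

/-- `χ(r) = 0` for `r ≥ 1/4`. [folklore] -/
theorem cutoff_eq_zero {r : ℝ} (hr : 1 / 4 ≤ r) : cutoff r = 0 :=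
  Real.smoothTransition.zero_of_nonpos (by linarith)

/-- `0 ≤ χ`. [folklore] -/
theorem cutoff_nonneg (r : ℝ) : 0 ≤ cutoff r := Real.smoothTransition.nonneg _

/-- `χ ≤ 1`. [folklore] -/
theorem cutoff_le_one (r : ℝ) : cutoff r ≤ 1 := Real.smoothTransition.le_one _

/-- The cutoff is smooth. [folklore] -/
theorem contDiff_cutoff {n : ℕ∞} : ContDiff ℝ n cutoff :=
  Real.smoothTransition.contDiff.comp (contDiff_const.sub (contDiff_const.mul contDiff_id))

/-! ## The homogeneous potential and field -/

/-- The degree-`(1-α)` homogeneous vector potential `Φ₀(z) = |z|^{1-α} W(z/|z|)` with angular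
profile `W : ℝ³ → ℝ³` (only `W` on the unit sphere matters off the origin; at `z = 0` the value is
the junk `0^{1-α} • W 0`). Its curl is Shvydkoy's homogeneous field of degree `-α`
(Shvydkoy, §1 eq. (2): `V(x) = (v + f n)/|x|^α`). [cite: Shvydkoy2017, §1 eq. (2)] -/
def homogeneousPotential (α : ℝ) (W : ℝ³ → ℝ³) (z : ℝ³) : ℝ³ :=
  (‖z‖ ^ (1 - α)) • W (‖z‖⁻¹ • z)

/-- The degree-`(-α)` homogeneous field `U_{α,W} = curl Φ₀`, `Φ₀ = homogeneousPotential α W`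
(divergence free off the origin, being a curl; Shvydkoy, §1 eq. (2)).
[cite: Shvydkoy2017, §1 eq. (2)] -/
def homogeneousField (α : ℝ) (W : ℝ³ → ℝ³) : ℝ³ → ℝ³ :=
  curl (homogeneousPotential α W)

/-- Unfolding `homogeneousField`. [folklore] -/
theorem homogeneousField_apply (α : ℝ) (W : ℝ³ → ℝ³) (z : ℝ³) :
    homogeneousField α W z = curl (fun z : ℝ³ => (‖z‖ ^ (1 - α)) • W (‖z‖⁻¹ • z)) z := rfl

/-! ## The truncated potential and the debris field on `ℝ³` -/

/-- The truncated potential `Φ(z) = (χ(|z|) |z|^{1-α}) • W(z/|z|)` — written exactly as in the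
route's `let D := …` (scalar factor `smoothTransition (2 - 8‖z‖) * ‖z‖ ^ (1 - α)`). [folklore] -/
def potential (α : ℝ) (W : ℝ³ → ℝ³) (z : ℝ³) : ℝ³ :=
  (Real.smoothTransition (2 - 8 * ‖z‖) * ‖z‖ ^ (1 - α)) • W (‖z‖⁻¹ • z)

/-- The debris field on `ℝ³`: `F_{α,W} = curl Φ`, `Φ = potential α W`. [folklore] -/
def field (α : ℝ) (W : ℝ³ → ℝ³) : ℝ³ → ℝ³ :=
  curl (potential α W)

/-- `Φ = χ(|z|) • Φ₀`. [folklore] -/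
theorem potential_eq_cutoff_smul (α : ℝ) (W : ℝ³ → ℝ³) (z : ℝ³) :
    potential α W z = cutoff ‖z‖ • homogeneousPotential α W z := by
  rw [potential, homogeneousPotential, smul_smul, cutoff]

/-- Near the origin the truncation is invisible: `Φ(z) = Φ₀(z)` for `|z| ≤ 1/8`. [folklore] -/
theorem potential_eq_homogeneousPotential {α : ℝ} {W : ℝ³ → ℝ³} {z : ℝ³} (hz : ‖z‖ ≤ 1 / 8) :
    potential α W z = homogeneousPotential α W z := by
  rw [potential_eq_cutoff_smul, cutoff_eq_one hz, one_smul]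

/-- The truncated potential vanishes for `|z| ≥ 1/4`. [folklore] -/
theorem potential_eq_zero {α : ℝ} {W : ℝ³ → ℝ³} {z : ℝ³} (hz : 1 / 4 ≤ ‖z‖) :
    potential α W z = 0 := by
  rw [potential_eq_cutoff_smul, cutoff_eq_zero hz, zero_smul]

/-- On the open ball of radius `1/8`, `Φ` and `Φ₀` agree near every point. [folklore] -/
theorem potential_eventuallyEq_homogeneousPotential {α : ℝ} {W : ℝ³ → ℝ³} {z : ℝ³}
    (hz : ‖z‖ < 1 / 8) : potential α W =ᶠ[𝓝 z] homogeneousPotential α W := by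
  have h : ∀ᶠ y in 𝓝 z, ‖y‖ < 1 / 8 := (continuous_norm.tendsto z).eventually (Iio_mem_nhds hz)
  filter_upwards [h] with y hy using potential_eq_homogeneousPotential hy.le

/-- Off the closed ball of radius `1/4`, `Φ` vanishes near every point. [folklore] -/
theorem potential_eventuallyEq_zero {α : ℝ} {W : ℝ³ → ℝ³} {z : ℝ³} (hz : 1 / 4 < ‖z‖) :
    potential α W =ᶠ[𝓝 z] fun _ => 0 := by
  have h : ∀ᶠ y in 𝓝 z, 1 / 4 < ‖y‖ := (continuous_norm.tendsto z).eventually (Ioi_mem_nhds hz)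
  filter_upwards [h] with y hy using potential_eq_zero hy.le

/-- The truncated potential has topological support in the closed ball of radius `1/4`. [folklore] -/
theorem tsupport_potential_subset (α : ℝ) (W : ℝ³ → ℝ³) :
    tsupport (potential α W) ⊆ closedBall (0 : ℝ³) (1 / 4) :=
  closure_minimal (fun _ hz => mem_closedBall_zero_iff.2
    (not_lt.1 fun h => hz (potential_eq_zero h.le))) isClosed_closedBall

/-- **Inner zone**: on the open ball of radius `1/8` the debris field *is* the homogeneous field
`U_{α,W}` (curl is local). [folklore] -/
theorem field_eq_homogeneousField {α : ℝ} {W : ℝ³ → ℝ³} {z : ℝ³} (hz : ‖z‖ < 1 / 8) :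
    field α W z = homogeneousField α W z := by
  rw [field, homogeneousField, curl_eq_curlCLM, curl_eq_curlCLM,
    (potential_eventuallyEq_homogeneousPotential hz).fderiv_eq]

/-- **Outer zone**: the debris field vanishes for `|z| > 1/4`. [folklore] -/
theorem field_eq_zero {α : ℝ} {W : ℝ³ → ℝ³} {z : ℝ³} (hz : 1 / 4 < ‖z‖) : field α W z = 0 := by
  rw [field, curl_eq_curlCLM, (potential_eventuallyEq_zero hz).fderiv_eq]
  simp

/-- The debris field has topological support in the closed ball of radius `1/4`. [folklore] -/
theorem tsupport_field_subset (α : ℝ) (W : ℝ³ → ℝ³) :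
    tsupport (field α W) ⊆ closedBall (0 : ℝ³) (1 / 4) :=
  closure_minimal (fun _ hz => mem_closedBall_zero_iff.2
    (not_lt.1 fun h => hz (field_eq_zero h))) isClosed_closedBall

/-- The debris field has compact support. [folklore] -/
theorem hasCompactSupport_field (α : ℝ) (W : ℝ³ → ℝ³) : HasCompactSupport (field α W) :=
  HasCompactSupport.of_support_subset_isCompact (isCompact_closedBall 0 (1 / 4))
    ((subset_tsupport _).trans (tsupport_field_subset α W))

/-! ## Smoothness off the origin; measurability -/

/-- For a `Cⁿ` profile, `Φ₀` is `Cⁿ` off the origin (norm, real powers and inversion are smooth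
away from `0`). [folklore] -/
theorem contDiffAt_homogeneousPotential {α : ℝ} {W : ℝ³ → ℝ³} {n : WithTop ℕ∞}
    (hW : ContDiff ℝ n W) {z : ℝ³} (hz : z ≠ 0) :
    ContDiffAt ℝ n (homogeneousPotential α W) z := by
  have hn : ContDiffAt ℝ n (fun y : ℝ³ => ‖y‖) z := contDiffAt_norm ℝ hz
  have hz' : ‖z‖ ≠ 0 := norm_ne_zero_iff.2 hz
  exact (hn.rpow_const_of_ne hz').smul (hW.contDiffAt.comp z ((hn.inv hz').smul contDiffAt_id))

/-- For a smooth profile the truncated potential is smooth off the origin. [folklore] -/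
theorem contDiffAt_potential {α : ℝ} {W : ℝ³ → ℝ³} {n : ℕ∞} (hW : ContDiff ℝ n W)
    {z : ℝ³} (hz : z ≠ 0) : ContDiffAt ℝ n (potential α W) z := by
  rw [show potential α W = fun z => cutoff ‖z‖ • homogeneousPotential α W z from
    funext (potential_eq_cutoff_smul α W)]
  exact (contDiff_cutoff.contDiffAt.comp z (contDiffAt_norm ℝ hz)).smul
    (contDiffAt_homogeneousPotential hW hz)

/-- The truncated potential of a smooth profile is smooth on `ℝ³ ∖ {0}`. [folklore] -/
theorem contDiffOn_potential {α : ℝ} {W : ℝ³ → ℝ³} {n : ℕ∞} (hW : ContDiff ℝ n W) :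
    ContDiffOn ℝ n (potential α W) {0}ᶜ := fun _ hz =>
  (contDiffAt_potential hW hz).contDiffWithinAt

/-- For a smooth profile the homogeneous field `U_{α,W}` is smooth off the origin. [folklore] -/
theorem contDiffAt_homogeneousField {α : ℝ} {W : ℝ³ → ℝ³} (hW : ContDiff ℝ ∞ W) {z : ℝ³}
    (hz : z ≠ 0) : ContDiffAt ℝ ∞ (homogeneousField α W) z :=
  contDiffAt_curl (contDiffAt_homogeneousPotential hW hz) (by simp)

/-- For a smooth profile the debris field is smooth off the origin (one singular point). [folklore] -/
theorem contDiffAt_field {α : ℝ} {W : ℝ³ → ℝ³} (hW : ContDiff ℝ ∞ W) {z : ℝ³} (hz : z ≠ 0) :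
    ContDiffAt ℝ ∞ (field α W) z :=
  contDiffAt_curl (contDiffAt_potential hW hz) (by simp)

/-- For a smooth profile the debris field is continuous off the origin. [folklore] -/
theorem continuousOn_field {α : ℝ} {W : ℝ³ → ℝ³} (hW : ContDiff ℝ ∞ W) :
    ContinuousOn (field α W) {0}ᶜ := fun _ hz =>
  (contDiffAt_field hW hz).continuousAt.continuousWithinAt

/-- The debris field is Borel measurable (for every profile, junk values included). [folklore] -/
theorem measurable_field (α : ℝ) (W : ℝ³ → ℝ³) : Measurable (field α W) :=
  measurable_curl _

/-! ## The centre of the cube and the debris field on `T³` -/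

/-- The centre `(½, ½, ½)` of the fundamental cube `[0,1)³`, written as in the route. [folklore] -/
def centre : ℝ³ := !₂[(1 : ℝ) / 2, 1 / 2, 1 / 2]

/-- Coordinates of the centre. [folklore] -/
@[simp]
theorem centre_apply (i : Fin 3) : centre i = 1 / 2 := by
  fin_cases i <;> simp [centre]

/-- A point outside the open unit cube is farther than `1/4` (indeed `≥ 1/2`) from the centre.
[folklore] -/
theorem lt_norm_sub_centre_of_not_mem_openCube {y : ℝ³} (hy : ¬ ∀ i, y i ∈ Ioo (0 : ℝ) 1) :
    1 / 4 < ‖y - centre‖ := by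
  obtain ⟨i, hi⟩ := not_forall.1 hy
  have h1 : |(y - centre) i| ≤ ‖y - centre‖ := by
    simpa [Real.norm_eq_abs] using PiLp.norm_apply_le (y - centre) i
  have h2 : (y - centre) i = y i - 1 / 2 := by simp
  rw [h2] at h1
  have h3 : 1 / 2 ≤ |y i - 1 / 2| := by
    rcases not_and_or.1 (mt mem_Ioo.2 hi) with h | h
    · rw [abs_of_nonpos (by linarith)]; linarith
    · rw [abs_of_nonneg (by linarith)]; linarith
  linarith

end CollapseDebris

open CollapseDebris

/-- **The point-collapse debris field on `T³`**: `D_{α,W}(x) = curl_z [χ(|z|) |z|^{1-α} W(z/|z|)]`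
at `z = repr x - (½,½,½)` — the truncated degree-`(-α)` homogeneous field of route DebrisQuanta
(card `onsager-quanta-collapse-exponent-map`), compactly supported in the ball of radius `1/4`
about the cube centre, equal near the centre to `U_{α,W} = curl (|z|^{1-α} W(ẑ))`, singular at one
point. By `rfl` this is the `let D := …` prefix of the route's items (`collapseDebris_eq`).
(Homogeneous ansatz: Shvydkoy, §1 eq. (2); energy dimension `3 - 2α`: Bronzi–Shvydkoy, Rem. 1.2.)
[folklore] -/
def collapseDebris (α : ℝ) (W : ℝ³ → ℝ³) (x : UnitAddTorus (Fin 3)) : ℝ³ :=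
  field α W (FunctionSpaces.Torus.repr x - centre)

/-- `collapseDebris α W x = field α W (repr x - centre)`. [folklore] -/
theorem collapseDebris_apply (α : ℝ) (W : ℝ³ → ℝ³) (x : UnitAddTorus (Fin 3)) :
    collapseDebris α W x = field α W (FunctionSpaces.Torus.repr x - centre) := rfl

/-- **Literal form**: `collapseDebris` is, by `rfl`, the term abbreviated by `let D := …` in the
items of route DebrisQuanta. [folklore] -/
theorem collapseDebris_eq (α : ℝ) (W : ℝ³ → ℝ³) (x : UnitAddTorus (Fin 3)) :
    collapseDebris α W x =
      curl (fun z : ℝ³ => (Real.smoothTransition (2 - 8 * ‖z‖) * ‖z‖ ^ (1 - α)) • W (‖z‖⁻¹ • z))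
        (FunctionSpaces.Torus.repr x - (!₂[(1 : ℝ) / 2, 1 / 2, 1 / 2] : ℝ³)) := rfl

/-- `D_{α,W}` vanishes where the cube representative is farther than `1/4` from the centre.
[folklore] -/
theorem collapseDebris_eq_zero {α : ℝ} {W : ℝ³ → ℝ³} {x : UnitAddTorus (Fin 3)}
    (hx : 1 / 4 < ‖FunctionSpaces.Torus.repr x - centre‖) : collapseDebris α W x = 0 :=
  field_eq_zero hx

/-- The debris field on `T³` is Borel measurable (`repr` is measurable). [folklore] -/
theorem measurable_collapseDebris (α : ℝ) (W : ℝ³ → ℝ³) : Measurable (collapseDebris α W) :=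
  (measurable_field α W).comp (FunctionSpaces.Torus.measurable_repr.sub_const centre)

/-- The debris field on `T³` is a.e. strongly measurable. [folklore] -/
theorem aestronglyMeasurable_collapseDebris (α : ℝ) (W : ℝ³ → ℝ³) :
    AEStronglyMeasurable (collapseDebris α W) volume :=
  (measurable_collapseDebris α W).aestronglyMeasurable

/-- The planar field `y ↦ F_{α,W}(y - centre)` vanishes off the open unit cube. [folklore] -/
theorem field_sub_centre_eq_zero_of_not_mem_openCube (α : ℝ) (W : ℝ³ → ℝ³) (y : ℝ³)
    (hy : ¬ ∀ i, y i ∈ Ioo (0 : ℝ) 1) : field α W (y - centre) = 0 :=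
  field_eq_zero (lt_norm_sub_centre_of_not_mem_openCube hy)

/-- **Periodisation bridge**: the debris field on `T³` is the torus periodisation
(`Torus.periodize`, `TorusPeriodization`) of the planar field `y ↦ F_{α,W}(y - centre)`, which is
supported in the open unit cube; hence the whole `periodize` dictionary (lift `= perSum`,
`∫_{T³} = ∫_{ℝ³}`, smoothness transfer) applies to `collapseDebris`. [folklore] -/
theorem collapseDebris_eq_periodize (α : ℝ) (W : ℝ³ → ℝ³) :
    collapseDebris α W = FunctionSpaces.Torus.periodize fun y => field α W (y - centre) := by
  funext x
  rw [FunctionSpaces.Torus.periodize_eq_apply_repr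
    (field_sub_centre_eq_zero_of_not_mem_openCube α W) x, collapseDebris_apply]

/-! ## Admissible profiles -/

namespace CollapseDebris

/-- **Admissible profile**: `W` is smooth and the homogeneous field `U_{α,W} = curl(|z|^{1-α}W(ẑ))`
does not vanish identically off the origin (so that the debris is a genuine degree-`(-α)`
singularity). By `Iff.rfl` the route's `let Adm := …` (`isAdmissibleProfile_iff`). [folklore] -/
def IsAdmissibleProfile (α : ℝ) (W : ℝ³ → ℝ³) : Prop :=
  ContDiff ℝ ∞ W ∧ ∃ y : ℝ³, y ≠ 0 ∧ homogeneousField α W y ≠ 0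

/-- **Literal form**: `IsAdmissibleProfile α W` is the term abbreviated by `let Adm := …` in the
items of route DebrisQuanta. [folklore] -/
theorem isAdmissibleProfile_iff (α : ℝ) (W : ℝ³ → ℝ³) :
    IsAdmissibleProfile α W ↔
      ContDiff ℝ ((⊤ : ℕ∞) : WithTop ℕ∞) W ∧ ∃ y : ℝ³, y ≠ 0 ∧
        curl (fun z : ℝ³ => (‖z‖ ^ (1 - α)) • W (‖z‖⁻¹ • z)) y ≠ 0 :=
  Iff.rfl

/-- An admissible profile is smooth. [folklore] -/
theorem IsAdmissibleProfile.contDiff {α : ℝ} {W : ℝ³ → ℝ³} (h : IsAdmissibleProfile α W) :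
    ContDiff ℝ ∞ W := h.1

/-! ### The explicit swirl profile `W₀ y = (0, y₀, 1)` -/

/-- The swirl profile `W₀(y) = (0, y₀, 1)` of item `DecayQuantumWeak` is smooth (affine).
[folklore] -/
theorem contDiff_swirl {n : WithTop ℕ∞} :
    ContDiff ℝ n fun y : ℝ³ => (!₂[0, y 0, 1] : ℝ³) := by
  rw [contDiff_euclidean]
  intro i
  fin_cases i
  · simpa using contDiff_const (c := (0 : ℝ))
  · simpa using (contDiff_piLp_apply (𝕜 := ℝ) (p := 2) (E := fun _ : Fin 3 => ℝ) (i := 0))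
  · simpa using contDiff_const (c := (1 : ℝ))

/-- At the pole `e₂ = (0,0,1)` the homogeneous field of the swirl profile has third component
`(curl Φ₀)(e₂)₂ = ∂₀Φ₀,₁ − ∂₁Φ₀,₀ = 1` (for every exponent `α`): `Φ₀,₁ = a(z) z₀` with
`a(e₂) = 1` and `z₀(e₂) = 0`, so `∂₀Φ₀,₁(e₂) = a(e₂) = 1`, while `Φ₀,₀ ≡ 0`. [folklore] -/
theorem homogeneousField_swirl_pole_apply_two (α : ℝ) :
    homogeneousField α (fun y : ℝ³ => (!₂[0, y 0, 1] : ℝ³)) (EuclideanSpace.single 2 1) 2 = 1 := by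
  set W : ℝ³ → ℝ³ := fun y => (!₂[0, y 0, 1] : ℝ³) with hW
  set p : ℝ³ := EuclideanSpace.single 2 1 with hp
  have hp0 : p ≠ 0 := by
    intro h
    have := congrArg (fun v : ℝ³ => v 2) h
    simp [hp] at this
  have hnorm : ‖p‖ = 1 := by simp [hp]
  -- differentiability of `Φ₀` at the pole
  have hΦ : DifferentiableAt ℝ (homogeneousPotential α W) p :=
    (contDiffAt_homogeneousPotential (n := 1) (contDiff_swirl (n := 1)) hp0).differentiableAt
      one_ne_zero
  -- coordinates of `DΦ₀(p) v` are derivatives of the coordinate functions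
  have hcoord : ∀ (i : Fin 3) (v : ℝ³), fderiv ℝ (homogeneousPotential α W) p v i =
      fderiv ℝ (fun z => homogeneousPotential α W z i) p v := by
    intro i v
    have h := ((PiLp.proj (𝕜 := ℝ) 2 (fun _ : Fin 3 => ℝ) i).hasFDerivAt.comp p hΦ.hasFDerivAt).fderiv
    rw [show (fun z => homogeneousPotential α W z i) =
        ⇑(PiLp.proj (𝕜 := ℝ) 2 (fun _ : Fin 3 => ℝ) i) ∘ homogeneousPotential α W from rfl, h]
    rfl
  -- `∂₁ Φ₀,₀ = 0`
  have h10 : fderiv ℝ (homogeneousPotential α W) p (EuclideanSpace.single 1 1) 0 = 0 := by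
    rw [hcoord]
    have : (fun z => homogeneousPotential α W z 0) = fun _ => (0 : ℝ) :=
      funext fun z => by simp [hW, homogeneousPotential]
    rw [this, fderiv_fun_const]
    rfl
  -- `∂₀ Φ₀,₁ = 1`
  have h01 : fderiv ℝ (homogeneousPotential α W) p (EuclideanSpace.single 0 1) 1 = 1 := by
    rw [hcoord]
    have hfun : (fun z => homogeneousPotential α W z 1) =
        fun z : ℝ³ => (‖z‖ ^ (1 - α) * ‖z‖⁻¹) * z 0 :=
      funext fun z => by simp [hW, homogeneousPotential, mul_assoc]
    rw [hfun]
    have hn : DifferentiableAt ℝ (fun z : ℝ³ => ‖z‖) p :=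
      (contDiffAt_norm ℝ hp0 (n := 1)).differentiableAt one_ne_zero
    have hn0 : ‖p‖ ≠ 0 := by rw [hnorm]; exact one_ne_zero
    have ha : DifferentiableAt ℝ (fun z : ℝ³ => ‖z‖ ^ (1 - α) * ‖z‖⁻¹) p :=
      (hn.rpow_const (Or.inl hn0)).mul (hn.inv hn0)
    have hb : HasFDerivAt (fun z : ℝ³ => z 0) (PiLp.proj (𝕜 := ℝ) 2 (fun _ : Fin 3 => ℝ) 0) p :=
      (PiLp.proj (𝕜 := ℝ) 2 (fun _ : Fin 3 => ℝ) 0).hasFDerivAt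
    rw [fderiv_fun_mul ha hb.differentiableAt, hb.fderiv]
    have hp0' : p 0 = 0 := by simp [hp]
    simp [hp0', hnorm]
  rw [homogeneousField, curl]
  simp only [Matrix.cons_val_two, Matrix.tail_cons, Matrix.head_cons]
  rw [h01, h10, sub_zero]

/-- **The swirl profile is admissible** for every exponent `α`: `W₀(y) = (0, y₀, 1)` is smooth and
`U_{α,W₀}(e₂) ≠ 0` (its third component is `1`). This is conjunct (ii) of item
`DebrisDatumRegular` (stated there for `α < 1`) and shows `IsAdmissibleProfile` is not vacuous.
[folklore] -/
theorem isAdmissibleProfile_swirl (α : ℝ) :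
    IsAdmissibleProfile α fun y : ℝ³ => (!₂[0, y 0, 1] : ℝ³) := by
  refine ⟨contDiff_swirl, EuclideanSpace.single 2 1, ?_, ?_⟩
  · intro h
    have := congrArg (fun v : ℝ³ => v 2) h
    simp at this
  · intro h
    have := congrArg (fun v : ℝ³ => v 2) h
    rw [homogeneousField_swirl_pole_apply_two] at this
    simp at this

end CollapseDebris

end Literature.Analysis.FluidPDE
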